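import Summits.CriticalPhenomena.PercolationContinuityZ3.Theorems.PercNearOneGluingNoHeavyRsw3LongBoxCrossing
import Summits.CriticalPhenomena.PercolationContinuityZ3.Theorems.PercAnnulusCrossingBoxCrossingDefs
import HarnessLib

/-!
# RSW3 lane (P2): the crossing window in the lane's vocabulary `Crossing.boxCross` (LADDER R1.b / R1.c′)

builds on p205010 (kernel theorem, internal audit signed; external expert review pending)

Cell `prim-rsw3`, seat `prim-rsw3-p2`; defs of `prim-rsw3-lead` (p207702).  Support file (`--supports
stmt-CriticalPhenomena-4575`); no definitions, no named facts, no sorries.  Transfers the seat's theorems (stated for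
centred boxes / bricks with `SurfaceTension.linked`) to Kesten's block crossing `Crossing.boxCross L i`:
* `real_linked_le_real_boxCross` — transfer lemma (every `d`, `p`): `R ⊆ v + ∏_j [0, M_j]`, `A ⊆ R ∩ {x_i = v_i}`,
  `B ⊆ {x_i = v_i + M_i}`, target `L` SHORTER in direction `i` (`0 ≤ L_i ≤ M_i`) and WIDER transversally
  (`M_j ≤ L_j`) ⇒ `P_p(A ↔ B in R) ≤ P_p(boxCross L i)` (translate by `-v`, cut the open path at its FIRST visit to
  the level `x_i = L_i`, `exists_firstVisit_level`);
* `pow_le_real_boxCross` — straight segment: `p^{L_i} ≤ P_p(boxCross L i)` (`0 ≤ L`);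
* `easyCrossingLowerBound` — **`Crossing.EasyCrossingLowerBound k` for every `k ≥ 2`** (instances `_two`, `_three`,
  `_four`): the `1:k` slab `{0..n} × {0..kn}²` is thin-crossed at `p_c(ℤ³)` with probability `≥ min (p_c^8)
  (85^{-3}/(3·21³))` for every `n ≥ 1` (`n ≤ 8`: segment; `n ≥ 9`: the `4:6` brick of mesh `⌈n/4⌉` of
  `Rsw3.le_real_slabCrossing_criticalProbI`).  `k = 1` is the cube (open, `CubeCrossingNondegenerate`);
* `exists_le_real_boxCross_cubeShape_even` (`c/L²` for the cube of even side `2L`) and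
  `exists_le_real_boxCross_hardShape` (`c/n^{16k+2}` for `hardShape k n`, every `n ≥ 1`, `k ≥ 1`, via the long box
  `T_{4k}(⌊n/4⌋)` of `Rsw3.exists_le_real_longBoxCrossing_criticalProbI`): RATES; `HardCrossingLowerBound k` stays open.

References: H. Kesten, *Percolation Theory for Mathematicians* (1982), §3.3 (3.28)–(3.32), (3.65), Thm. 5.1;
G. Grimmett, *Percolation* (1999), §1.6, §11.7; G. Kozma, A. Nachmias, J. Amer. Math. Soc. 24 (2011), §3. [folklore]
-/


noncomputable section

namespace Summit.CriticalPhenomena.PercolationContinuityZ3.Theorems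

open MeasureTheory ProbabilityTheory Filter Topology
open Literature.Probability.Percolation Literature.Probability.LatticeModels
open Literature.Barriers.CriticalPhenomena

namespace Rsw3

open SurfaceTension Crossing

variable {d : ℕ}

/-- **First visit to a level.** A nearest-neighbour walk of `ℤ^d` (in a subgraph `H ≤ ℤ^d`) from `a` with
`a_i ≤ ℓ` to `b` with `ℓ ≤ b_i` has a first index `s` at which the `i`-th coordinate equals `ℓ`; before it the
`i`-th coordinate is `≤ ℓ` (steps change a coordinate by at most one). [folklore] -/
theorem exists_firstVisit_level {H : SimpleGraph (Site d)} (hH : H ≤ zdGraph d) {a b : Site d}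
    (W : H.Walk a b) (i : Fin d) {ℓ : ℤ} (ha : a i ≤ ℓ) (hb : ℓ ≤ b i) :
    ∃ s : ℕ, s ≤ W.length ∧ W.getVert s i = ℓ ∧ ∀ r, r ≤ s → W.getVert r i ≤ ℓ := by
  classical
  have hex : ∃ s : ℕ, s ≤ W.length ∧ ℓ ≤ W.getVert s i := ⟨W.length, le_rfl, by rwa [W.getVert_length]⟩
  set s := Nat.find hex with hs
  obtain ⟨hsl, hsℓ⟩ := Nat.find_spec hex
  have hmin : ∀ r, r < s → W.getVert r i < ℓ := by
    intro r hr
    by_contra hge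
    push Not at hge
    exact Nat.find_min hex hr ⟨(le_of_lt hr).trans hsl, hge⟩
  have heq : W.getVert s i = ℓ := by
    refine le_antisymm ?_ hsℓ
    rcases Nat.eq_zero_or_pos s with h0 | hpos
    · have : W.getVert s = a := by rw [h0, SimpleGraph.Walk.getVert_zero]
      rw [this]; exact ha
    · obtain ⟨s', hs'⟩ : ∃ s', s = s' + 1 := ⟨s - 1, by omega⟩
      have hlt : W.getVert s' i < ℓ := hmin s' (by omega)
      have hadj : H.Adj (W.getVert s') (W.getVert (s' + 1)) := W.adj_getVert_succ (by omega)
      have h1 := (coord_sub_le_one_of_adj (hH hadj) i).2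
      rw [hs']
      linarith
  refine ⟨s, hsl, heq, fun r hr => ?_⟩
  rcases hr.lt_or_eq with hlt | hrs
  · exact (hmin r hlt).le
  · rw [hrs, heq]

/-- **From a linking event to Kesten's block crossing** (every `d`, `p`).  Let `R ⊆ v + ∏_j [0, M_j]`,
`A ⊆ R ∩ {x | x_i = v_i}`, `B ⊆ {x | x_i = v_i + M_i}`, and let the target side vector `L` satisfy `0 ≤ L_i ≤ M_i`
(shorter in the crossing direction) and `M_j ≤ L_j` for `j ≠ i` (wider transversally).  Then
`P_p(A ↔ B in R) ≤ P_p(boxCross L i)`: after translating by `-v`, an open path inside `R` from `A` to `B`, cut at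
its first visit to the level `x_i = L_i`, is an open path inside `{0..L}` from `{x_i = 0}` to `{x_i = L_i}`. [folklore] -/
theorem real_linked_le_real_boxCross (p : unitInterval) {R A B : Set (Site d)} {v M L : Site d} (i : Fin d)
    (hR : R ⊆ {x | ∀ j, v j ≤ x j ∧ x j ≤ v j + M j}) (hAR : A ⊆ R) (hA : A ⊆ {x | x i = v i})
    (hB : B ⊆ {x | x i = v i + M i}) (hLi : 0 ≤ L i) (hLM : L i ≤ M i) (hML : ∀ j, j ≠ i → M j ≤ L j) :
    (bondPercolation (zdGraph d) p).real (linked R A B) ≤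
      (bondPercolation (zdGraph d) p).real (boxCross L i) := by
  classical
  -- translate by `-v`
  set φ : zdGraph d ≃g zdGraph d := zdShiftIso (-v) with hφ
  have hφx : ∀ x : Site d, φ x = x - v := fun x => by simp [hφ, sub_eq_add_neg]
  rw [← real_linked_image φ p R A B]
  refine DCT16.real_mono_of_forall_subset_edgeSet (zdGraph d) p fun ω hω h => ?_
  rw [mem_linked_iff] at h
  obtain ⟨a', ha', b', hb', hab⟩ := h
  obtain ⟨a, ha, rfl⟩ := ha'
  obtain ⟨b, hb, rfl⟩ := hb'
  -- coordinates after translation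
  have hR' : ∀ x ∈ (φ : Site d → Site d) '' R, ∀ j, 0 ≤ x j ∧ x j ≤ M j := by
    rintro _ ⟨x, hx, rfl⟩ j
    have h := hR hx j
    rw [hφx]
    simp only [Pi.sub_apply]
    constructor <;> linarith [h.1, h.2]
  have hai : (φ a) i = 0 := by rw [hφx]; simp only [Pi.sub_apply]; have := hA ha; simp only [Set.mem_setOf_eq] at this; linarith
  have hbi : (φ b) i = M i := by rw [hφx]; simp only [Pi.sub_apply]; have := hB hb; simp only [Set.mem_setOf_eq] at this; linarith
  -- the walk and its first visit to the level `L i`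
  rw [mem_inConn_iff] at hab
  obtain ⟨W⟩ := hab
  have hHle : openGraph ω ⊓ withinGraph (zdGraph d) ((φ : Site d → Site d) '' R) ≤ zdGraph d :=
    fun x y hxy => (withinGraph_adj.1 hxy.2).1
  have hHR : openGraph ω ⊓ withinGraph (zdGraph d) (⇑φ '' R) ≤ withinGraph (zdGraph d) (⇑φ '' R) := inf_le_right
  obtain ⟨s, hsl, hsi, hle⟩ := exists_firstVisit_level hHle W i (ℓ := L i) (hai ▸ hLi) (hbi ▸ hLM)
  -- the initial segment lies in the block `{0..L}`
  set C : Set (Site d) := (↑(Finset.Icc (0 : Site d) L) : Set (Site d)) with hC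
  have hmemC : ∀ r, r ≤ s → W.getVert r ∈ C := by
    intro r hr
    have hxR : W.getVert r ∈ (φ : Site d → Site d) '' R :=
      getVert_mem_of_le_withinGraph hHR W ⟨a, hAR ha, rfl⟩ r
    have hx := hR' _ hxR
    rw [hC, Finset.mem_coe, Finset.mem_Icc]
    refine ⟨fun j => (hx j).1, fun j => ?_⟩
    by_cases hj : j = i
    · subst hj; exact hle r hr
    · exact (hx j).2.trans (hML j hj)
  have hreach := reachable_getVert_of_forall_mem hHle W C 0 s (by omega) fun r _ hr => hmemC r (by omega)
  rw [SimpleGraph.Walk.getVert_zero, Nat.zero_add] at hreach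
  have hreach' : (openGraph ω ⊓ withinGraph (zdGraph d) C).Reachable (φ a) (W.getVert s) :=
    hreach.mono (le_inf (inf_le_left.trans inf_le_left) inf_le_right)
  -- conclude: `φ a ↔ W_s` inside the block, `(φ a)_i = 0`, `(W_s)_i = L_i`
  have haC : φ a ∈ C := by simpa using hmemC 0 (Nat.zero_le s)
  have hsC : W.getVert s ∈ C := hmemC s le_rfl
  refine ⟨φ a, Finset.mem_coe.1 haC, W.getVert s, Finset.mem_coe.1 hsC, hai, hsi, ?_⟩
  rw [openConnIn_eq_openConnVia haC]
  exact openConnVia_mono_graph (Quant.withinGraph_le_withinGraph_top _) _ _ (mem_inConn_iff.2 hreach')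

/-- **A straight open segment crosses the block**: for `0 ≤ L`, `p^{L_i} ≤ P_p(boxCross L i)` — the `L_i` edges of the
segment `t e_i`, `0 ≤ t ≤ L_i`, open. [folklore] -/
theorem pow_le_real_boxCross (p : unitInterval) {L : Site d} (hL : ∀ j, 0 ≤ L j) (i : Fin d) :
    (p : ℝ) ^ (L i).toNat ≤ (bondPercolation (zdGraph d) p).real (boxCross L i) := by
  classical
  set m := (L i).toNat with hm
  have hmL : ((m : ℕ) : ℤ) = L i := by rw [hm, Int.toNat_of_nonneg (hL i)]
  -- the points `t e_i` and the edges between consecutive ones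
  set pt : ℕ → Site d := fun t => (Pi.single i (t : ℤ) : Site d) with hpt
  have hpt_apply : ∀ (t : ℕ) (j : Fin d), pt t j = if j = i then (t : ℤ) else 0 := fun t j => by
    simp only [hpt, Pi.single_apply]
  have hpt_mem : ∀ t, t ≤ m → pt t ∈ (↑(Finset.Icc (0 : Site d) L) : Set (Site d)) := by
    intro t ht
    rw [Finset.mem_coe, Finset.mem_Icc]
    refine ⟨fun j => ?_, fun j => ?_⟩
    · rw [hpt_apply]; split_ifs <;> simp
    · rw [hpt_apply]; split_ifs with h
      · rw [h, ← hmL]; exact Int.ofNat_le.mpr ht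
      · exact hL j
  have hadj : ∀ t, (zdGraph d).Adj (pt t) (pt (t + 1)) := by
    intro t
    rw [zdGraph_adj_iff]
    refine ⟨i, Or.inl ?_⟩
    funext j
    simp only [hpt_apply, Pi.add_apply, Pi.single_apply]
    split_ifs
    · push_cast; ring
    · simp
  set F : Finset (Sym2 (Site d)) := (Finset.range m).image fun t => s(pt t, pt (t + 1)) with hF
  have hFE : (↑F : Set (Sym2 (Site d))) ⊆ (zdGraph d).edgeSet := by
    intro e he
    rw [hF, Finset.coe_image] at he
    obtain ⟨t, -, rfl⟩ := he
    exact (SimpleGraph.mem_edgeSet _).2 (hadj t)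
  have hcard : F.card ≤ m := (Finset.card_image_le).trans (Finset.card_range m).le
  -- `{F ⊆ ω} ⊆ boxCross L i`
  have hsub : {ω : BondConfig (Site d) | (↑F : Set (Sym2 (Site d))) ⊆ ω} ⊆ boxCross L i := by
    intro ω hω
    have hconn : ∀ t, t ≤ m → ω ∈ openConnIn (↑(Finset.Icc (0 : Site d) L) : Set (Site d)) (pt 0) (pt t) := by
      intro t
      induction t with
      | zero => exact fun _ => mem_openConnIn_rfl (hpt_mem 0 (Nat.zero_le m)) ω
      | succ t ih =>
        intro ht
        have he : s(pt t, pt (t + 1)) ∈ ω := by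
          apply hω
          rw [hF, Finset.coe_image]
          exact ⟨t, Finset.mem_coe.2 (Finset.mem_range.2 (by omega)), rfl⟩
        exact mem_openConnIn_trans_of_subset (ih (by omega))
          (mem_openConnIn_of_mem_edge (hpt_mem t (by omega)) (hpt_mem (t + 1) ht) (hadj t) he)
          subset_rfl subset_rfl
    refine ⟨pt 0, Finset.mem_coe.1 (hpt_mem 0 (Nat.zero_le m)), pt m, Finset.mem_coe.1 (hpt_mem m le_rfl),
      by rw [hpt_apply]; simp, by rw [hpt_apply, if_pos rfl, hmL], hconn m le_rfl⟩
  calc (p : ℝ) ^ m ≤ (p : ℝ) ^ F.card := pow_le_pow_of_le_one p.2.1 p.2.2 hcard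
    _ = (bondPercolation (zdGraph d) p).real {ω | (↑F : Set (Sym2 (Site d))) ⊆ ω} :=
        (bondPercolation_real_setOf_subset (zdGraph d) p F hFE).symm
    _ ≤ _ := measureReal_mono hsub

/-- **`EasyCrossingLowerBound k` for every `k ≥ 2`.** At `p_c(ℤ³)` the slab `{0..n} × {0..kn}²` is crossed inside
itself in its thin direction with probability at least `min (p_c^8) (85^{-3}/(3·21³))` for every `n ≥ 1`: for `n ≤ 8`
a straight open segment (`pow_le_real_boxCross`), for `n ≥ 9` the `4:6` brick `[u,5u] × [0,6u]²` of mesh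
`u = ⌈n/4⌉` (`Rsw3.le_real_slabCrossing_criticalProbI`, thickness `4u ≥ n`, width `6u ≤ 2n ≤ kn`) transferred by
`real_linked_le_real_boxCross`.  Closes the obligation nodes `Crossing.EasyCrossingLowerBound k`, `k ≥ 2`
(LADDER R1.b asked for `k = 4`); `k = 1` is the cube and stays open. [folklore] -/
theorem easyCrossingLowerBound {k : ℕ} (hk : 2 ≤ k) : Crossing.EasyCrossingLowerBound k := by
  classical
  unfold Crossing.EasyCrossingLowerBound Crossing.CrossingLowerBound
  set pc : unitInterval := criticalProbI 3 with hpc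
  have hpc0 : (0 : ℝ) < pc := by
    rw [hpc, coe_criticalProbI]; exact criticalProb_zd_pos 3 (by norm_num)
  set c₁ : ℝ := (17062234875 : ℝ)⁻¹ with hc₁
  refine ⟨min ((pc : ℝ) ^ 8) c₁, lt_min (by positivity) (by rw [hc₁]; positivity), fun n hn => ?_⟩
  have hshape : ∀ j : Fin 3, 0 ≤ easyShape k n j := by
    intro j; fin_cases j <;> simp [easyShape] <;> positivity
  by_cases h8 : n ≤ 8
  · -- a straight open segment of `n` edges
    have hseg := pow_le_real_boxCross pc hshape 0
    have h0 : (easyShape k n 0).toNat = n := by simp [easyShape]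
    rw [h0] at hseg
    calc min ((pc : ℝ) ^ 8) c₁ ≤ (pc : ℝ) ^ 8 := min_le_left _ _
      _ ≤ (pc : ℝ) ^ n := pow_le_pow_of_le_one pc.2.1 pc.2.2 h8
      _ ≤ _ := hseg
  · -- the `4:6` brick of mesh `u = ⌈n/4⌉`
    push Not at h8
    set u : ℕ := (n + 3) / 4 with hu
    have hu1 : 1 ≤ u := by omega
    have h4u : n ≤ 4 * u := by omega
    have h6u : 6 * u ≤ k * n := by nlinarith [show 6 * u ≤ 2 * n by omega]
    have hbrick := le_real_slabCrossing_criticalProbI (d := 3) (by norm_num) hu1 (by norm_num : 1 ≤ 4)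
      (0 : Fin 3) (0 : Site 3)
    have hc₁le : c₁ ≤ (bondPercolation (zdGraph 3) (criticalProbI 3)).real (slabCrossing u 4 (0 : Fin 3) 0) :=
      le_trans (by rw [hc₁]; norm_num) hbrick
    have htransfer : (bondPercolation (zdGraph 3) (criticalProbI 3)).real (slabCrossing u 4 (0 : Fin 3) 0) ≤
        (bondPercolation (zdGraph 3) (criticalProbI 3)).real (boxCross (easyShape k n) 0) := by
      refine real_linked_le_real_boxCross (criticalProbI 3) (R := midSlab u 4 (0 : Fin 3) 0)
        (A := loFace u 4 (0 : Fin 3) 0) (B := hiFace u 4 (0 : Fin 3) 0)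
        (v := ![(u : ℤ), 0, 0]) (M := ![4 * (u : ℤ), 6 * u, 6 * u]) (L := easyShape k n) 0
        ?_ ?_ ?_ ?_ ?_ ?_ ?_
      · intro x hx j
        simp only [midSlab, Set.mem_setOf_eq, Pi.zero_apply, mul_zero, zero_add] at hx
        obtain ⟨hall, hlo, hhi⟩ := hx
        fin_cases j
        · simp; constructor <;> push_cast at hlo hhi ⊢ <;> linarith
        · have := hall 1; simp; push_cast at this ⊢; constructor <;> linarith [this.1, this.2]
        · have := hall 2; simp; push_cast at this ⊢; constructor <;> linarith [this.1, this.2]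
      · exact fun x hx => hx.1
      · intro x hx
        simp only [loFace, Set.mem_setOf_eq, Pi.zero_apply, mul_zero, zero_add] at hx
        simp [hx.2]
      · intro x hx
        simp only [hiFace, Set.mem_setOf_eq, Pi.zero_apply, mul_zero, zero_add] at hx
        simp [hx.2]; ring
      · exact hshape 0
      · simp [easyShape]; exact_mod_cast h4u
      · intro j hj
        fin_cases j
        · exact absurd rfl hj
        · simp [easyShape]; exact_mod_cast h6u
        · simp [easyShape]; exact_mod_cast h6u
    calc min ((pc : ℝ) ^ 8) c₁ ≤ c₁ := min_le_right _ _
      _ ≤ _ := hc₁le.trans htransfer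

/-- **`EasyCrossingLowerBound 2`** — the `1:2` slab `{0..n} × {0..2n}²` (the wide box of `BlockerRSW3D`) is crossed the
thin way at `p_c(ℤ³)` with probability bounded below uniformly in `n`. [folklore] -/
theorem easyCrossingLowerBound_two : Crossing.EasyCrossingLowerBound 2 := easyCrossingLowerBound le_rfl

/-- **`EasyCrossingLowerBound 3`** — Kesten's sponge shape `(n, 3n, 3n)`. [cite: Kesten1982, (3.65) and Thm. 5.1] -/
theorem easyCrossingLowerBound_three : Crossing.EasyCrossingLowerBound 3 := easyCrossingLowerBound (by norm_num)

/-- **`EasyCrossingLowerBound 4`** — LADDER R1.b as assigned. [folklore] -/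
theorem easyCrossingLowerBound_four : Crossing.EasyCrossingLowerBound 4 := easyCrossingLowerBound (by norm_num)

/-- **The critical cube of even side, in the lane's vocabulary**: there is `c > 0` with
`c / L² ≤ P_{p_c(ℤ³)}(boxCross (cubeShape (2L)) 0)` for all `L ≥ 1` — transfer of
`Rsw3.exists_le_real_cubeCrossing_criticalProbI_three` (`Λ(L) = [-L, L]³ ≅ {0..2L}³`).  A RATE; the uniform
statement `CrossingLowerBound cubeShape 0` (half of `CubeCrossingNondegenerate`) stays open. [folklore] -/
theorem exists_le_real_boxCross_cubeShape_even :
    ∃ c : ℝ, 0 < c ∧ ∀ L : ℕ, 1 ≤ L →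
      c / (L : ℝ) ^ 2 ≤ (bondPercolation (zdGraph 3) (criticalProbI 3)).real (boxCross (cubeShape (2 * L)) 0) := by
  obtain ⟨c, hc, h⟩ := exists_le_real_cubeCrossing_criticalProbI_three
  refine ⟨c, hc, fun L hL => (h L hL 0).trans ?_⟩
  refine real_linked_le_real_boxCross (criticalProbI 3) (R := (↑(box 3 L) : Set (Site 3)))
    (A := cubeFace L 0 (-1)) (B := cubeFace L 0 1)
    (v := ![-(L : ℤ), -L, -L]) (M := ![2 * (L : ℤ), 2 * L, 2 * L]) (L := cubeShape (2 * L)) 0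
    ?_ ?_ ?_ ?_ ?_ ?_ ?_
  · intro x hx j
    rw [Finset.mem_coe, mem_box] at hx
    fin_cases j
    · have := hx 0; simp; constructor <;> linarith [this.1, this.2]
    · have := hx 1; simp; constructor <;> linarith [this.1, this.2]
    · have := hx 2; simp; constructor <;> linarith [this.1, this.2]
  · exact fun x hx => hx.1
  · intro x hx
    simp only [cubeFace, Set.mem_setOf_eq, Units.val_neg, Units.val_one, neg_mul, one_mul] at hx
    simp; linarith [hx.2]
  · intro x hx
    simp only [cubeFace, Set.mem_setOf_eq, Units.val_one, one_mul] at hx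
    simp [hx.2]; ring
  · simp [cubeShape]
  · simp [cubeShape]
  · intro j hj
    fin_cases j
    · exact absurd rfl hj
    · simp [cubeShape]
    · simp [cubeShape]

/-- **Polynomial floor for every hard shape and every side.** For `k ≥ 1` there is `c = c(k) > 0` with
`c / n^{16k+2} ≤ P_{p_c(ℤ³)}(boxCross (hardShape k n) 0)` for all `n ≥ 1`: for `n ≤ 3` a straight open segment of
`kn ≤ 3k` edges; for `n ≥ 4` the long box `T_{4k}(q)`, `q = ⌊n/4⌋` (length `(8k+4)q ≥ kn`, width `4q ≤ n`), of
`Rsw3.exists_le_real_longBoxCrossing_criticalProbI` (`≥ c₀^{4k+1}/q^{16k+2}`), transferred by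
`real_linked_le_real_boxCross`.  The cube is `hardShape 1` (`≥ c/n^{18}` for every side `n`; `c/L²` for even sides,
`exists_le_real_boxCross_cubeShape_even`).  Rates only: `HardCrossingLowerBound k` stays open. [folklore] -/
theorem exists_le_real_boxCross_hardShape {k : ℕ} (hk : 1 ≤ k) :
    ∃ c : ℝ, 0 < c ∧ ∀ n : ℕ, 1 ≤ n →
      c / (n : ℝ) ^ (16 * k + 2) ≤
        (bondPercolation (zdGraph 3) (criticalProbI 3)).real (boxCross (hardShape k n) 0) := by
  classical
  set pc : unitInterval := criticalProbI 3 with hpc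
  have hpc0 : (0 : ℝ) < pc := by
    rw [hpc, coe_criticalProbI]; exact criticalProb_zd_pos 3 (by norm_num)
  obtain ⟨c₀, hc₀, hlong⟩ := exists_le_real_longBoxCrossing_criticalProbI (d := 3) (by norm_num)
  refine ⟨min ((pc : ℝ) ^ (3 * k)) (c₀ ^ (4 * k + 1)), lt_min (by positivity) (by positivity), fun n hn => ?_⟩
  have hshape : ∀ j : Fin 3, 0 ≤ hardShape k n j := by
    intro j
    fin_cases j <;> simp [hardShape]
    positivity
  have hdivle : min ((pc : ℝ) ^ (3 * k)) (c₀ ^ (4 * k + 1)) / (n : ℝ) ^ (16 * k + 2) ≤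
      min ((pc : ℝ) ^ (3 * k)) (c₀ ^ (4 * k + 1)) := div_le_self (by positivity) (one_le_pow₀ (by exact_mod_cast hn))
  by_cases h3 : n ≤ 3
  · -- a straight open segment of `k n ≤ 3 k` edges
    have hseg := pow_le_real_boxCross pc hshape 0
    have h0 : (hardShape k n 0).toNat = k * n := by
      simp [hardShape]; norm_cast
    rw [h0] at hseg
    have hkn : k * n ≤ 3 * k := by nlinarith
    calc min ((pc : ℝ) ^ (3 * k)) (c₀ ^ (4 * k + 1)) / (n : ℝ) ^ (16 * k + 2)
        ≤ min ((pc : ℝ) ^ (3 * k)) (c₀ ^ (4 * k + 1)) := hdivle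
      _ ≤ (pc : ℝ) ^ (3 * k) := min_le_left _ _
      _ ≤ (pc : ℝ) ^ (k * n) := pow_le_pow_of_le_one pc.2.1 pc.2.2 hkn
      _ ≤ _ := hseg
  · -- the long box `T_{4k}(q)`, `q = ⌊n/4⌋`
    push Not at h3
    set q : ℕ := n / 4 with hq
    have hq1 : 1 ≤ q := by omega
    have h4q : 4 * q ≤ n := by omega
    have hn4q : n ≤ 4 * q + 3 := by omega
    have hlen : k * n ≤ 2 * (4 * k) * q + 4 * q := by nlinarith
    have hL := hlong q hq1 0 (4 * k)
    have hexp : (2 * (4 * k) + 1) * (3 - 1) = 16 * k + 2 := by omega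
    rw [hexp] at hL
    -- `c₀^{4k+1}/n^e ≤ c₀^{4k+1}/q^e`
    have hq0 : (0 : ℝ) < q := by exact_mod_cast hq1
    have hqn : (q : ℝ) ≤ n := by exact_mod_cast (show q ≤ n by omega)
    have hstep1 : min ((pc : ℝ) ^ (3 * k)) (c₀ ^ (4 * k + 1)) / (n : ℝ) ^ (16 * k + 2) ≤
        c₀ ^ (4 * k + 1) / (q : ℝ) ^ (16 * k + 2) := by
      calc min ((pc : ℝ) ^ (3 * k)) (c₀ ^ (4 * k + 1)) / (n : ℝ) ^ (16 * k + 2)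
          ≤ c₀ ^ (4 * k + 1) / (n : ℝ) ^ (16 * k + 2) :=
            div_le_div_of_nonneg_right (min_le_right _ _) (by positivity)
        _ ≤ c₀ ^ (4 * k + 1) / (q : ℝ) ^ (16 * k + 2) := by
            apply div_le_div_of_nonneg_left (by positivity) (by positivity)
            exact pow_le_pow_left₀ hq0.le hqn _
    refine hstep1.trans (hL.trans ?_)
    -- transfer the long-box crossing to the block `{0..hardShape k n}`
    refine real_linked_le_real_boxCross (criticalProbI 3)
      (R := {y : Site 3 | (-(2 * q : ℤ) ≤ y 0 ∧ y 0 ≤ 2 * (4 * k : ℕ) * q + 2 * q) ∧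
        ∀ i, i ≠ 0 → -(2 * q : ℤ) ≤ y i ∧ y i ≤ 2 * q})
      (A := cubeFace (2 * q) 0 (-1))
      (B := (zdShiftIso (Pi.single 0 (2 * ((4 * k : ℕ) : ℤ) * q) : Site 3)) '' cubeFace (2 * q) 0 1)
      (v := ![-(2 * q : ℤ), -(2 * q), -(2 * q)])
      (M := ![2 * (4 * k : ℤ) * q + 4 * q, 4 * q, 4 * q]) (L := hardShape k n) 0
      ?_ ?_ ?_ ?_ ?_ ?_ ?_
    · intro y hy j
      obtain ⟨hy0, hyi⟩ := hy
      fin_cases j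
      · simp; push_cast at hy0 ⊢; constructor <;> linarith [hy0.1, hy0.2]
      · have := hyi 1 (by decide); simp; constructor <;> linarith [this.1, this.2]
      · have := hyi 2 (by decide); simp; constructor <;> linarith [this.1, this.2]
    · intro x hx
      simp only [cubeFace, Set.mem_setOf_eq, Units.val_neg, Units.val_one, neg_mul, one_mul] at hx
      obtain ⟨hxbox, hx0⟩ := hx
      rw [mem_box] at hxbox
      refine ⟨?_, fun i hi => ?_⟩
      · have := hxbox 0; push_cast at this hx0 ⊢
        have hk0 : (0 : ℤ) ≤ 2 * (4 * (k : ℤ)) * q := by positivity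
        constructor <;> linarith [this.1]
      · have := hxbox i; push_cast at this ⊢; exact this
    · intro x hx
      simp only [cubeFace, Set.mem_setOf_eq, Units.val_neg, Units.val_one, neg_mul, one_mul] at hx
      simp; push_cast at hx ⊢; linarith [hx.2]
    · rintro y ⟨x, hx, rfl⟩
      simp only [cubeFace, Set.mem_setOf_eq, Units.val_one, one_mul] at hx
      simp [zdShiftIso_apply, hx.2]; ring
    · exact hshape 0
    · simp [hardShape]; exact_mod_cast hlen
    · intro j hj
      fin_cases j
      · exact absurd rfl hj
      · simp [hardShape]; exact_mod_cast h4q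
      · simp [hardShape]; exact_mod_cast h4q

end Rsw3

end Summit.CriticalPhenomena.PercolationContinuityZ3.Theorems

end
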